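import Summits.RiemannHypothesis.RiemannHypothesis.Theorems.Splittings.NbMertensZerosFloor
import Literature.NumberTheory.LFunctions.RiemannHypothesisUpToRSCertificate
import HarnessLib

/-!
# NB Burnol floor from certified runs of sign changes of Hardy's `Z` (SPLIT-nb-neg gen 8, §14)

Cell rh-split, seat rh-split-nb-neg g8 (brief sha16 f79c5f09d8bcb036), card
`run/shared/lean/pub/rh-split/cards/SPLIT-nb-neg.md` §14.  Companion of `NbMertensZerosFloor.lean`.

Burnol's refinement of the Báez-Duarte–Balazard–Landreau–Saias bound gives, for every finite set `T` of
critical zeros of `ζ`, `liminf (log N) d_N² ≥ Σ_{ρ ∈ T} m_ρ²/|ρ|²` (tree: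
`NbHalfDoubling.two_pi_mul_sum_multSq_le_of_frequently_nbRateBound`, in the `∫ |1−ζA|²/(¼+t²) = 2π d_N²`
normalisation).  `NbMertensZerosFloor.lean` feeds it the 2000 Odlyzko–te Riele zeros (floor `0.28467`).  This
file adds EVERY zero of a tree-certified RUN of alternating signs of Hardy's `Z`
(`Literature.NumberTheory.LFunctions.RSCert.AltRun`, the format of the tree's `RiemannHypothesisUpTo 10000 / 100000`
certificates): between two consecutive samples `q_i/2^e < q_{i+1}/2^e` with `Z(q_i/2^e) Z(q_{i+1}/2^e) < 0` there is
a zero `½ + iγ`, `γ < q_{i+1}/2^e`, contributing `1/|ρ|² ≥ 1/(¼ + (q_{i+1}/2^e)²)`; zeros of a run that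
starts above `t₂(1999)` are distinct from the 2000 bracketed ones, so the two floors ADD.

Contents (all hypothesis-form, standard axioms; the compiled evaluations are in `NbBurnolFloorRunsEval.lean`):
1. `runFloorTerm`, `runFloorAux`, `runFloorInt` (three small computational definitions: the integer floor
   `Σ_i ⌊2⁶²4^e/(4^e+4q_{i+1}²)⌋`, unit `2⁻⁶⁰`, tail-recursive), `runFloorInt_cons`, `runFloorTerm_le`;
2. `altRun_suffix` (a run drops a prefix), `exists_finset_pos_zeros_of_altRun` (zeros from a run with
   the weighted floor — intermediate value theorem for `Z`, `hardyZ_eq_zero_iff_holds`);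
3. `exists_finset_pos_zeros_of_checks` (the 2000 zeros with their height window `0 < γ ≤ t₂(1999)`),
   `exists_finset_zeros_multSq_of_pos` (conjugates double the sum, `m_ρ ≥ 1`);
4. `four_pi_mul_sum_le_of_frequently_nbRateBound_of_run`, `four_pi_mul_le_of_frequently_nbRateBound_of_run`
   (`C ≥ 4π(Lₘ + Lᵣ)2⁻⁶⁰` for every frequently admissible `C`), `not_nb_rateTail_of_lt_of_run`.

HONEST LABEL: «SPLITTING SEARCH over kernel-typed RH-EQUIVALENCES; a splitting A ∧ B ⟹ RH is CONDITIONAL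
bookkeeping unless A and B are both proved; nothing here bears on the truth of RH.»

References: [Burnol2002] J.-F. Burnol, *A lower bound in an approximation problem involving the zeros of
the Riemann zeta function*, Adv. Math. 170 (2002) 56–70, Thm. 1.3; [Brent1979] R. P. Brent, Math. Comp. 33
(1979) 1361–1372, §3 (zeros on the line from sign changes of `Z`); [OdlyzkoTeRiele1985] §4.2 p. 151.
-/

set_option linter.dupNamespace false

noncomputable section

open Complex MeasureTheory Set Filter Topology
open scoped Real ENNReal ComplexConjugate

namespace Summit.RiemannHypothesis.RiemannHypothesis.Theorems.Splittings.NbBurnolFloorRuns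

open Summit.RiemannHypothesis.RiemannHypothesis.Theorems
open Summit.RiemannHypothesis.RiemannHypothesis.Theorems.Splittings.NbHalfDoubling
open Summit.RiemannHypothesis.RiemannHypothesis.Theorems.Splittings.NbMertensZerosFloor
open Literature.NumberTheory.LFunctions Literature.Barriers.RiemannHypothesis
open Literature.NumberTheory.LFunctions.ZetaNumerics.Mertens
open Literature.NumberTheory.LFunctions.RSCert (AltRun sgnZ mul_neg_of_sgnZ)

/-! ## 1. Zeros from a run of certified alternating signs of Hardy's `Z`, with the weighted floor -/

/-- One floor term (unit `2⁻⁶⁰`): `⌊2⁶²·4^e/(4^e + 4q²)⌋ ≤ 2⁶⁰/(¼ + (q/2^e)²)`. [folklore] -/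
def runFloorTerm (e q : ℕ) : ℤ := (2 : ℤ) ^ 62 * 2 ^ (2 * e) / (2 ^ (2 * e) + 4 * (q : ℤ) ^ 2)

/-- Accumulator form of the run floor (tail-recursive, for compiled evaluation on long runs). [folklore] -/
def runFloorAux (e : ℕ) : ℤ → ℕ → List ℕ → ℤ
  | acc, _, [] => acc
  | acc, p, g :: gs => runFloorAux e (acc + runFloorTerm e (p + g)) (p + g) gs

/-- **Integer floor of a run** (unit `2⁻⁶⁰`): `Σ_{i<|L|} ⌊2⁶²·4^e/(4^e + 4 q_{i+1}²)⌋` over the run points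
`q_{i+1} = p + g₁ + ⋯ + g_{i+1}` after the first (each gap of the run holds a zero `½ + iγ` with
`γ < q_{i+1}/2^e`, contributing `1/|ρ|² ≥ 1/(¼ + (q_{i+1}/2^e)²)`). With `runFloorTerm`, `runFloorAux` the
three computational definitions of this file. [folklore] -/
def runFloorInt (e p : ℕ) (L : List ℕ) : ℤ := runFloorAux e 0 p L

/-- The accumulator is additive. [folklore] -/
theorem runFloorAux_eq (e : ℕ) : ∀ (L : List ℕ) (acc : ℤ) (p : ℕ),
    runFloorAux e acc p L = acc + runFloorAux e 0 p L
  | [], acc, p => by simp [runFloorAux]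
  | g :: gs, acc, p => by
    simp only [runFloorAux, zero_add]
    rw [runFloorAux_eq e gs (acc + _), runFloorAux_eq e gs (runFloorTerm e (p + g))]
    ring

/-- `runFloorInt e p [] = 0`. [folklore] -/
theorem runFloorInt_nil (e p : ℕ) : runFloorInt e p [] = 0 := rfl

/-- `runFloorInt e p (g :: gs) = runFloorTerm e (p+g) + runFloorInt e (p+g) gs`. [folklore] -/
theorem runFloorInt_cons (e p g : ℕ) (gs : List ℕ) :
    runFloorInt e p (g :: gs) = runFloorTerm e (p + g) + runFloorInt e (p + g) gs := by
  unfold runFloorInt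
  simp only [runFloorAux, zero_add]
  exact runFloorAux_eq e gs _ _

/-- One term: `⌊2⁶²·4^e/(4^e + 4q²)⌋ ≤ 2⁶⁰ / (¼ + (q/2^e)²)`. [folklore] -/
theorem runFloorTerm_le (e q : ℕ) :
    ((runFloorTerm e q : ℤ) : ℝ) ≤ 2 ^ 60 * (1 / (1 / 4 + ((q : ℝ) / 2 ^ e) ^ 2)) := by
  unfold runFloorTerm
  have hD : (0 : ℤ) < 2 ^ (2 * e) + 4 * (q : ℤ) ^ 2 := by positivity
  have h1 : (((2 : ℤ) ^ 62 * 2 ^ (2 * e) / (2 ^ (2 * e) + 4 * (q : ℤ) ^ 2) : ℤ) : ℝ) *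
      ((2 : ℝ) ^ (2 * e) + 4 * (q : ℝ) ^ 2) ≤ (2 : ℝ) ^ 62 * 2 ^ (2 * e) := by
    have := Int.ediv_mul_le ((2 : ℤ) ^ 62 * 2 ^ (2 * e)) hD.ne'
    exact_mod_cast this
  have hDr : (0 : ℝ) < (2 : ℝ) ^ (2 * e) + 4 * (q : ℝ) ^ 2 := by positivity
  have hE : (0 : ℝ) < (2 : ℝ) ^ e := by positivity
  have hpow : (2 : ℝ) ^ (2 * e) = (2 ^ e) ^ 2 := by rw [← pow_mul, mul_comm]
  rw [← le_div_iff₀ hDr] at h1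
  refine h1.trans (le_of_eq ?_)
  rw [hpow]
  field_simp
  ring

/-- **A run drops a prefix**: after `n` gaps the rest of the run is a run from the point reached.
[cite: Brent1979, §3] -/
theorem altRun_suffix {e : ℕ} : ∀ (n : ℕ) {p : ℕ} {s : Bool} {L : List ℕ}, AltRun e p s L →
    ∃ s' : Bool, AltRun e (p + (L.take n).sum) s' (L.drop n)
  | 0, p, s, L, h => ⟨s, by simpa using h⟩
  | n + 1, p, s, [], h => ⟨s, by simpa using h⟩
  | n + 1, p, s, g :: gs, h => by
    obtain ⟨_, _, hrest⟩ := h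
    obtain ⟨s', h'⟩ := altRun_suffix n hrest
    refine ⟨s', ?_⟩
    simpa [List.take_succ_cons, List.drop_succ_cons, List.sum_cons, add_assoc] using h'

/-- **Zeros from a run, with the weighted floor.** A run of certified alternating signs of `Z` along
`p/2^e < q₁/2^e < ⋯` yields a finite set `F` of zeros `½ + iγ` of `ζ` (one in each gap, `γ > p/2^e`) with
`Σ_{z ∈ F} 1/|z|² ≥ runFloorInt/2⁶⁰`. [cite: Brent1979, §3 Theorems 3.1–3.2] -/
theorem exists_finset_pos_zeros_of_altRun {e : ℕ} : ∀ {L : List ℕ} {p : ℕ} {s : Bool}, AltRun e p s L →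
    ∃ F : Finset ℂ, (∀ z ∈ F, riemannZeta z = 0 ∧ z.re = 1 / 2 ∧ (p : ℝ) / 2 ^ e < z.im) ∧
      ((runFloorInt e p L : ℤ) : ℝ) / 2 ^ 60 ≤ ∑ z ∈ F, 1 / ‖z‖ ^ 2
  | [], p, s, _ => ⟨∅, by simp, by simp [runFloorInt_nil]⟩
  | g :: gs, p, s, h => by
    classical
    obtain ⟨hp, hg, hrest⟩ := h
    obtain ⟨F, hF, hsum⟩ := exists_finset_pos_zeros_of_altRun hrest
    -- a zero of `Z` strictly between the two sample points
    have hneg := mul_neg_of_sgnZ hp hrest.head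
    set a : ℝ := (p : ℝ) / 2 ^ e with ha
    set b : ℝ := ((p + g : ℕ) : ℝ) / 2 ^ e with hb
    have hab : a < b := by
      rw [ha, hb]; push_cast
      have : (0 : ℝ) < g := by exact_mod_cast hg
      exact div_lt_div_of_pos_right (by linarith) (by positivity)
    have hcont : ContinuousOn hardyZ (Set.Icc a b) := continuous_hardyZ.continuousOn
    have hγ : ∃ γ ∈ Set.Ioo a b, hardyZ γ = 0 := by
      have hne : hardyZ a ≠ 0 := fun h0 ↦ by
        rw [h0, zero_mul] at hneg; exact lt_irrefl _ hneg
      rcases lt_or_gt_of_ne hne with hlt | hgt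
      · have hb0 : 0 < hardyZ b := by
          by_contra hle
          have := mul_nonneg_of_nonpos_of_nonpos hlt.le (not_lt.1 hle)
          linarith
        obtain ⟨γ, hγ, h0⟩ := intermediate_value_Ioo hab.le hcont ⟨hlt, hb0⟩
        exact ⟨γ, hγ, h0⟩
      · have hb0 : hardyZ b < 0 := by
          by_contra hle
          have := mul_nonneg hgt.le (not_lt.1 hle)
          linarith
        obtain ⟨γ, hγ, h0⟩ := intermediate_value_Ioo' hab.le hcont ⟨hb0, hgt⟩
        exact ⟨γ, hγ, h0⟩
    obtain ⟨γ, ⟨hγa, hγb⟩, hZ⟩ := hγ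
    set ρ : ℂ := 1 / 2 + γ * I with hρ
    have hρim : ρ.im = γ := by simp [hρ]
    have hρre : ρ.re = 1 / 2 := by simp [hρ]
    have hζ : riemannZeta ρ = 0 := (hardyZ_eq_zero_iff_holds γ).1 hZ
    have hnot : ρ ∉ F := fun hmem ↦ by
      have := (hF ρ hmem).2.2
      rw [hρim] at this
      linarith
    refine ⟨insert ρ F, fun z hz ↦ ?_, ?_⟩
    · rcases Finset.mem_insert.1 hz with rfl | hz
      · exact ⟨hζ, hρre, by rw [hρim]; exact hγa⟩
      · obtain ⟨h1, h2, h3⟩ := hF z hz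
        refine ⟨h1, h2, lt_trans ?_ h3⟩
        exact hab.trans_le (le_of_eq hb)
    · rw [Finset.sum_insert hnot]
      have hterm := runFloorTerm_le e (p + g)
      have hn : ‖ρ‖ ^ 2 = 1 / 4 + γ ^ 2 := by rw [hρ]; exact norm_sq_one_half_add γ
      have hγ0 : 0 ≤ γ := le_trans (by rw [ha]; positivity) hγa.le
      have hγb' : γ ≤ ((p + g : ℕ) : ℝ) / 2 ^ e := by rw [← hb]; exact hγb.le
      have hmono : 1 / (1 / 4 + (((p + g : ℕ) : ℝ) / 2 ^ e) ^ 2) ≤ 1 / ‖ρ‖ ^ 2 := by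
        rw [hn]
        exact one_div_le_one_div_of_le (by positivity) (by nlinarith)
      rw [runFloorInt_cons]
      push_cast
      rw [add_div]
      have h60 : (0 : ℝ) < 2 ^ 60 := by positivity
      have hterm' : ((runFloorTerm e (p + g) : ℤ) : ℝ) / 2 ^ 60 ≤
          1 / (1 / 4 + (((p + g : ℕ) : ℝ) / 2 ^ e) ^ 2) := by
        rw [div_le_iff₀ h60]
        linarith [hterm]
      push_cast at hterm' hsum hmono ⊢
      linarith

/-! ## 2. The 2000 Odlyzko–te Riele zeros as a positive-ordinate family below `t₂(1999)` -/

/-- The first half of `NbMertensZerosFloor.exists_finset_zeros_sum_ge_of_checks`, with the height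
window recorded: `2000` distinct zeros `½ + iγ_j`, `0 < γ_j ≤ t₂(1999)`, `Σ 1/|ρ_j|² ≥ Σ_j 1/(¼ + t₂ⱼ²)`.
[cite: OdlyzkoTeRiele1985, §4.2 p. 151] -/
theorem exists_finset_pos_zeros_of_checks (hCh : ∀ k < NCHUNK, checkChunk k = true) :
    ∃ F : Finset ℂ, (∀ z ∈ F, riemannZeta z = 0 ∧ z.re = 1 / 2 ∧ 0 < z.im ∧ z.im ≤ t₂ (NZ - 1)) ∧
      ∑ j ∈ Finset.range NZ, 1 / (1 / 4 + t₂ j ^ 2) ≤ ∑ z ∈ F, 1 / ‖z‖ ^ 2 := by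
  classical
  obtain ⟨hgeo, hsep⟩ := brackets_separated_of_checks hCh
  have hfact : ∀ j < NZ, ∃ γ ∈ Set.Icc (t₁ j) (t₂ j), riemannZeta (1 / 2 + γ * I) = 0 :=
    fun j hj ↦ (zero_in_bracket_of_checks hCh hj).2
  set γ : ℕ → ℝ := fun j ↦ if h : j < NZ then (hfact j h).choose else 0 with hγdef
  have hγ : ∀ j < NZ, γ j ∈ Set.Icc (t₁ j) (t₂ j) ∧ riemannZeta (1 / 2 + γ j * I) = 0 := by
    intro j hj
    have := (hfact j hj).choose_spec
    simp only [hγdef, dif_pos hj]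
    exact this
  have hγinj : Set.InjOn γ (Finset.range NZ : Set ℕ) := by
    intro j hj j' hj' h
    simp only [Finset.coe_range, Set.mem_Iio] at hj hj'
    by_contra hne
    rcases lt_or_gt_of_ne hne with hlt | hlt
    · have := hsep j j' hlt hj'
      linarith [(hγ j hj).1.2, (hγ j' hj').1.1]
    · have := hsep j' j hlt hj
      linarith [(hγ j' hj').1.2, (hγ j hj).1.1]
  have htop : ∀ j < NZ, t₂ j ≤ t₂ (NZ - 1) := by
    intro j hj
    rcases Nat.lt_or_ge j (NZ - 1) with hlt | hge
    · exact ((hsep j (NZ - 1) hlt (by unfold NZ; norm_num)).trans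
        (hgeo (NZ - 1) (by unfold NZ; norm_num)).2).le
    · have : j = NZ - 1 := by omega
      rw [this]
  set ρ : ℕ → ℂ := fun j ↦ 1 / 2 + γ j * I with hρdef
  have hρim : ∀ j, (ρ j).im = γ j := fun j ↦ by simp [hρdef]
  have hρre : ∀ j, (ρ j).re = 1 / 2 := fun j ↦ by simp [hρdef]
  have hinj : Set.InjOn ρ (Finset.range NZ : Set ℕ) := by
    intro j hj j' hj' h
    have him : γ j = γ j' := by rw [← hρim j, ← hρim j', h]
    exact hγinj hj hj' him
  refine ⟨(Finset.range NZ).image ρ, fun z hz ↦ ?_, ?_⟩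
  · rw [Finset.mem_image] at hz
    obtain ⟨j, hj, rfl⟩ := hz
    rw [Finset.mem_range] at hj
    refine ⟨(hγ j hj).2, hρre j, ?_, ?_⟩
    · rw [hρim]; linarith [(hgeo j hj).1, (hγ j hj).1.1]
    · rw [hρim]; exact (hγ j hj).1.2.trans (htop j hj)
  · rw [Finset.sum_image hinj]
    refine Finset.sum_le_sum fun j hj ↦ ?_
    rw [Finset.mem_range] at hj
    have h0 : 0 ≤ γ j := le_trans (by norm_num) ((hgeo j hj).1.trans (hγ j hj).1.1)
    have hle : γ j ≤ t₂ j := (hγ j hj).1.2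
    have hn : ‖ρ j‖ ^ 2 = 1 / 4 + γ j ^ 2 := by
      simp only [hρdef]; exact norm_sq_one_half_add (γ j)
    rw [hn]
    exact one_div_le_one_div_of_le (by positivity) (by nlinarith)

/-! ## 3. Doubling by conjugation and the combined floor -/

/-- From positive-ordinate critical zeros to the Burnol sum: adding the conjugates doubles `Σ 1/|ρ|²`,
and `m_ρ ≥ 1` at every zero. [cite: Burnol2002, Thm. 1.3] -/
theorem exists_finset_zeros_multSq_of_pos (F : Finset ℂ)
    (hF : ∀ z ∈ F, riemannZeta z = 0 ∧ z.re = 1 / 2 ∧ 0 < z.im) :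
    ∃ G : Finset ℂ, (∀ ρ ∈ G, riemannZeta ρ = 0 ∧ ρ.re = 1 / 2) ∧
      2 * ∑ z ∈ F, 1 / ‖z‖ ^ 2 ≤ ∑ ρ ∈ G, (riemannZetaZeroOrder ρ : ℝ) ^ 2 / ‖ρ‖ ^ 2 := by
  classical
  have hdisj : Disjoint F (F.image conj) := by
    rw [Finset.disjoint_left]
    intro z hz hz'
    obtain ⟨z₀, hz₀, rfl⟩ := Finset.mem_image.1 hz'
    have h1 := (hF _ hz).2.2
    have h2 := (hF _ hz₀).2.2
    rw [Complex.conj_im] at h1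
    linarith
  refine ⟨F ∪ F.image conj, fun z hz ↦ ?_, ?_⟩
  · rcases Finset.mem_union.1 hz with h | h
    · exact ⟨(hF z h).1, (hF z h).2.1⟩
    · obtain ⟨z₀, hz₀, rfl⟩ := Finset.mem_image.1 h
      refine ⟨?_, by rw [Complex.conj_re]; exact (hF z₀ hz₀).2.1⟩
      rw [riemannZeta_conj, (hF z₀ hz₀).1, map_zero]
  · have hm : ∀ z : ℂ, riemannZeta z = 0 → z.re = 1 / 2 →
        1 / ‖z‖ ^ 2 ≤ (riemannZetaZeroOrder z : ℝ) ^ 2 / ‖z‖ ^ 2 := by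
      intro z hz hre
      have hne : z ≠ 1 := fun h ↦ by norm_num [h] at hre
      have h1 : (1 : ℤ) ≤ riemannZetaZeroOrder z := (riemannZetaZeroOrder_pos_iff hne).2 hz
      have h1' : (1 : ℝ) ≤ (riemannZetaZeroOrder z : ℝ) := by exact_mod_cast h1
      exact div_le_div_of_nonneg_right (one_le_pow₀ h1') (sq_nonneg _)
    have hsumG : ∑ z ∈ F ∪ F.image conj, 1 / ‖z‖ ^ 2 = 2 * ∑ z ∈ F, 1 / ‖z‖ ^ 2 := by
      rw [Finset.sum_union hdisj, Finset.sum_image fun x _ y _ h ↦ (starRingEnd ℂ).injective h]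
      simp only [Complex.norm_conj]
      ring
    rw [← hsumG]
    refine Finset.sum_le_sum fun z hz ↦ ?_
    rcases Finset.mem_union.1 hz with h | h
    · exact hm z (hF z h).1 (hF z h).2.1
    · obtain ⟨z₀, hz₀, rfl⟩ := Finset.mem_image.1 h
      refine hm _ ?_ (by rw [Complex.conj_re]; exact (hF z₀ hz₀).2.1)
      rw [riemannZeta_conj, (hF z₀ hz₀).1, map_zero]

/-- **Combined finite-family Burnol bound (frequently form): the 2000 Odlyzko–te Riele zeros plus every
zero of a run starting above them.** If `C` is frequently admissible, the twenty Mertens block checks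
pass, and `AltRun e p s L` is a run of certified alternating signs of `Z` with `p/2^e ≥ t₂(1999)`, then
`C ≥ 2π · 2 · (Σ_{j<2000} 1/(¼+t₂ⱼ²) + runFloorInt e p L / 2⁶⁰)`.
[cite: Burnol2002, Thm. 1.3 and Thm. 5.4] [cite: Brent1979, §3] [cite: OdlyzkoTeRiele1985, §4.2 p. 151] -/
theorem four_pi_mul_sum_le_of_frequently_nbRateBound_of_run (hCh : ∀ k < NCHUNK, checkChunk k = true)
    {e p : ℕ} {s : Bool} {L : List ℕ} (hrun : AltRun e p s L) (hτ : t₂ (NZ - 1) ≤ (p : ℝ) / 2 ^ e)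
    {C : ℝ}
    (hC : ∃ᶠ N : ℕ in atTop, ∃ a : Fin N → ℂ, ∫⁻ t : ℝ, ENNReal.ofReal (‖1 - riemannZeta (1 / 2 + t * Complex.I) *
        ∑ n : Fin N, a n * ((n : ℂ) + 1) ^ (-(1 / 2 + t * Complex.I))‖ ^ 2 / (1 / 4 + t ^ 2)) ≤
      ENNReal.ofReal (C / Real.log N)) :
    2 * π * (2 * (∑ j ∈ Finset.range NZ, 1 / (1 / 4 + t₂ j ^ 2) +
      ((runFloorInt e p L : ℤ) : ℝ) / 2 ^ 60)) ≤ C := by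
  classical
  obtain ⟨F₁, hF₁, hsum₁⟩ := exists_finset_pos_zeros_of_checks hCh
  obtain ⟨F₂, hF₂, hsum₂⟩ := exists_finset_pos_zeros_of_altRun hrun
  have hdisj : Disjoint F₁ F₂ := by
    rw [Finset.disjoint_left]
    intro z h1 h2
    have := (hF₁ z h1).2.2.2
    have := (hF₂ z h2).2.2
    linarith
  have hpos : (0 : ℝ) ≤ (p : ℝ) / 2 ^ e := by positivity
  obtain ⟨G, hG, hsumG⟩ := exists_finset_zeros_multSq_of_pos (F₁ ∪ F₂) fun z hz ↦ by
    rcases Finset.mem_union.1 hz with h | h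
    · exact ⟨(hF₁ z h).1, (hF₁ z h).2.1, (hF₁ z h).2.2.1⟩
    · exact ⟨(hF₂ z h).1, (hF₂ z h).2.1, hpos.trans_lt (hF₂ z h).2.2⟩
  rw [Finset.sum_union hdisj] at hsumG
  have h := two_pi_mul_sum_multSq_le_of_frequently_nbRateBound hC G hG
  have h2 : 2 * π * (2 * (∑ j ∈ Finset.range NZ, 1 / (1 / 4 + t₂ j ^ 2) +
      ((runFloorInt e p L : ℤ) : ℝ) / 2 ^ 60)) ≤
      2 * π * ∑ ρ ∈ G, (riemannZetaZeroOrder ρ : ℝ) ^ 2 / ‖ρ‖ ^ 2 :=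
    mul_le_mul_of_nonneg_left (by linarith) (by positivity)
  linarith

/-- **Numeric form.** With the integer certificates `Lₘ ≤ Σ_j ⌊2⁵⁴⁰/(2⁴⁷⁸+(a_j+1)²)⌋` (Mertens zeros) and
`Lᵣ ≤ runFloorInt e p L` (run), every frequently admissible `C` satisfies `4π (Lₘ + Lᵣ) 2⁻⁶⁰ ≤ C`.
[cite: Burnol2002, Thm. 1.3] -/
theorem four_pi_mul_le_of_frequently_nbRateBound_of_run (hCh : ∀ k < NCHUNK, checkChunk k = true)
    {Lm : ℤ} (hS : Lm ≤ ∑ j ∈ Finset.range NZ, (2 : ℤ) ^ 540 / (2 ^ 478 + (ordinate j + 1) ^ 2))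
    {e p : ℕ} {s : Bool} {L : List ℕ} (hrun : AltRun e p s L) (hτ : t₂ (NZ - 1) ≤ (p : ℝ) / 2 ^ e)
    {Lr : ℤ} (hLr : Lr ≤ runFloorInt e p L)
    {C : ℝ}
    (hC : ∃ᶠ N : ℕ in atTop, ∃ a : Fin N → ℂ, ∫⁻ t : ℝ, ENNReal.ofReal (‖1 - riemannZeta (1 / 2 + t * Complex.I) *
        ∑ n : Fin N, a n * ((n : ℂ) + 1) ^ (-(1 / 2 + t * Complex.I))‖ ^ 2 / (1 / 4 + t ^ 2)) ≤
      ENNReal.ofReal (C / Real.log N)) :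
    4 * π * (((Lm : ℝ) + Lr) / 2 ^ 60) ≤ C := by
  have h1 := four_pi_mul_sum_le_of_frequently_nbRateBound_of_run hCh hrun hτ hC
  have h2 := sum_inv_ge_of_int_le hS
  have h3 : ((Lr : ℤ) : ℝ) / 2 ^ 60 ≤ ((runFloorInt e p L : ℤ) : ℝ) / 2 ^ 60 :=
    div_le_div_of_nonneg_right (by exact_mod_cast hLr) (by positivity)
  clear hS hLr hCh hC hrun
  have h4 : 4 * π * (((Lm : ℝ) + Lr) / 2 ^ 60) ≤ 2 * π * (2 * (∑ j ∈ Finset.range NZ, 1 / (1 / 4 + t₂ j ^ 2) +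
      ((runFloorInt e p L : ℤ) : ℝ) / 2 ^ 60)) := by
    have : ((Lm : ℝ) + Lr) / 2 ^ 60 = (Lm : ℝ) / 2 ^ 60 + (Lr : ℝ) / 2 ^ 60 := by ring
    rw [this]
    nlinarith [Real.pi_pos, h2, h3]
  linarith

/-- **Rate-tail refutation below the combined floor** (`∀ N ≥ H` form): no `C` with
`4π(Lₘ+Lᵣ)2⁻⁶⁰ > C` is an admissible NB rate constant. [cite: Burnol2002, Thm. 1.3] -/
theorem not_nb_rateTail_of_lt_of_run (hCh : ∀ k < NCHUNK, checkChunk k = true)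
    {Lm : ℤ} (hS : Lm ≤ ∑ j ∈ Finset.range NZ, (2 : ℤ) ^ 540 / (2 ^ 478 + (ordinate j + 1) ^ 2))
    {e p : ℕ} {s : Bool} {L : List ℕ} (hrun : AltRun e p s L) (hτ : t₂ (NZ - 1) ≤ (p : ℝ) / 2 ^ e)
    {Lr : ℤ} (hLr : Lr ≤ runFloorInt e p L)
    {C : ℝ} (hlt : C < 4 * π * (((Lm : ℝ) + Lr) / 2 ^ 60)) (H : ℕ) :
    ¬ ∀ N : ℕ, H ≤ N → ∃ a : Fin N → ℂ, ∫⁻ t : ℝ, ENNReal.ofReal (‖1 - riemannZeta (1 / 2 + t * Complex.I) *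
        ∑ n : Fin N, a n * ((n : ℂ) + 1) ^ (-(1 / 2 + t * Complex.I))‖ ^ 2 / (1 / 4 + t ^ 2)) ≤
      ENNReal.ofReal (C / Real.log N) := by
  intro hall
  have hev : ∀ᶠ N : ℕ in atTop, ∃ a : Fin N → ℂ, ∫⁻ t : ℝ, ENNReal.ofReal (‖1 - riemannZeta (1 / 2 + t * Complex.I) *
        ∑ n : Fin N, a n * ((n : ℂ) + 1) ^ (-(1 / 2 + t * Complex.I))‖ ^ 2 / (1 / 4 + t ^ 2)) ≤
      ENNReal.ofReal (C / Real.log N) :=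
    Filter.eventually_atTop.2 ⟨H, hall⟩
  have := four_pi_mul_le_of_frequently_nbRateBound_of_run hCh hS hrun hτ hLr hev.frequently
  linarith

end Summit.RiemannHypothesis.RiemannHypothesis.Theorems.Splittings.NbBurnolFloorRuns

end
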